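import Summits.QuantumFields.YangMills.Theorems.IRcofFluxProjectionAdaptedSpectralData
import HarnessLib

/-!
# The vacuum sector of the flux projection is NEUTRAL in an adapted eigenbasis; interlacing from
# «charged weight ≤ (κ/2) × excited neutral weight» (crux `IRcof` ⟨stmt-QuantumFields-26930⟩, line `flux_interlacing_v2`
# 1bda929b912cc52d, stub I = `stub_fluxInterlacingEv` — helper lane; I itself NOT proved)

Cell `ym-gapexp` (R2c), director-ym R660-ym (1)(iv); sequel of `IRcofFluxProjectionAdaptedSpectralData.lean` (✓p818915) and
`IRcofAdaptedSpectralDataCore.lean` (✓p818348).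

WHAT IS PROVED (finite-volume transfer-matrix bookkeeping at ONE box and ONE `β ≥ 0`; def-free):

* ★ `adaptedSpectralData_twistGroup_vacuum` — the adapted spectral data of a finite abelian group of central temporal twists
  (`adaptedSpectralData_twistGroup`) WITH THE VACUUM INDEX: there is `i₀` with `0 ≤ λᵢ ≤ λ_{i₀}`, `0 < λ_{i₀}` (`= ‖A‖`, Jentzsch:
  `IsPositivityImproving.exists_top_eigenvector_of_isCompactOperator`, `exists_index_eq_norm`) and `w_{i₀} = 1` — 't Hooft's «the vacuum
  carries no electric flux» (§4), from the tree's `integral_twisted_coeff_top` (`⟪U_a A b₀, A b₀⟫ = λ₀²` for every kernel-preserving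
  measure-preserving twist) averaged over the group: `⟪P b₀, b₀⟫ = 1 = w₀`.
* ★ `adaptedSpectralData_projZ_vacuum` — the same for `projZ ρ β z n L` (the twist group `(Fin n)³`).
* ★ `interlaced_of_charged_le_half_excited` — THE HONEST SPECTRAL TARGET BEHIND STUB I: writing `E(t) := projZ(t) − λ₀^t = Σ_{wᵢ=1, i≠i₀} λᵢ^t`
  (excited NEUTRAL weight) and `C(t) := Z(t) − projZ(t) = Σ_{wᵢ=0} λᵢ^t` (CHARGED ∕ electric-flux weight), one has
  `projZ(2t) ≤ λ₀^{2t} + λ₀^t E(t) ≤ (λ₀^t + E(t)/2)²`, hence `projZ(t) − √projZ(2t) ≥ E(t)/2`; so for `κ ≥ 0`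
  «`C(t) ≤ (κ/2)·E(t)`» ⟹ `InterlacedAt ρ β z n κ L` (VERBATIM body, `t = L/4 ≥ 2`).  In words: a cold box is `κ`-interlaced as soon as
  its electric-flux spectral weight is at most `κ/2` times its excited-glue spectral weight at Euclidean time `L/4`.

WHAT THIS IS NOT.  The physics of I (neutral `ε₀`-purity ⇒ heavy electric flux = confinement at the scale `ln(2d/ε₀)/m`, CUT-5/10) is
NOT proved; nothing on `NeutralPurityCof`, `IRcof`, `IR`, or the Yang–Mills mass gap (Clay), which is NOT proved.  Finite-volume ∕ conditional.

References: G. 't Hooft, Nucl. Phys. B 153 (1979) 141, §§4–5; M. Reed, B. Simon, *Methods of Modern Mathematical Physics* IV (1978)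
Thm XIII.43–44 (Perron–Frobenius ∕ Jentzsch), I (1980) Thm VI.16, VI.22–23; I. Montvay, G. Münster (1994) §3.2.6 (3.145).
-/

noncomputable section

open scoped BigOperators ENNReal
open MeasureTheory Filter Function
open Literature.Analysis.OperatorTheory Literature.MathematicalPhysics.QuantumFieldTheory
open Summit.QuantumFields.YangMills.Cruxes.IRcof.TemporalTwistSubadditivity (eTwist zVec projZ eTwist_eq_elecMag)
open Summit.QuantumFields.YangMills.Theorems.IRcofFluxProjectionAdaptedSpectralData (zVec_fin_zero zVec_fin_add
  zVec_castSucc_mem_center)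

namespace Summit.QuantumFields.YangMills.Theorems.IRcofFluxProjectionVacuumSector

variable {G : Type} [Group G] [TopologicalSpace G] [IsTopologicalGroup G] [CompactSpace G]
  [MeasurableSpace G] [BorelSpace G] [SecondCountableTopology G] {N : ℕ} {ρ : G →* Matrix (Fin N) (Fin N) ℂ}

/-! ### §1 Adapted spectral data with the vacuum index -/

/-- ★ **Adapted spectral data of a finite abelian twist group, with the NEUTRAL VACUUM** (`β ≥ 0`, continuous unitary `ρ`, every box):
as `IRcofFluxProjectionAdaptedSpectralData.adaptedSpectralData_twistGroup`, plus an index `i₀` with `0 ≤ λᵢ ≤ λ_{i₀}`, `0 < λ_{i₀}` and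
`w_{i₀} = 1` («the vacuum carries no electric flux», 't Hooft §4; Jentzsch ∕ Perron–Frobenius for the positivity-improving transfer
operator). [cite: tHooft1979Flux, §4 (4.3)–(4.5)] [cite: ReedSimonIV1978, Thm XIII.43 and Thm XIII.44] [cite: MontvayMunster1994, §3.2.6 (3.145)] -/
theorem adaptedSpectralData_twistGroup_vacuum (hρ : Continuous ρ) (hρu : ∀ x, ρ x ∈ Matrix.unitaryGroup (Fin N) ℂ) {β : ℝ}
    (hβ : 0 ≤ β) {Γ : Type} [AddCommGroup Γ] [Fintype Γ] {Z : Γ → Fin 4 → G} (hZ0 : Z 0 = 1)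
    (hZadd : ∀ a b, Z (a + b) = Z a * Z b) (hZc : ∀ (a : Γ) (i : Fin 3), Z a i.castSucc ∈ Subgroup.center G)
    (b₁ b₂ b₃ : ℕ) :
    ∃ (ι : Type) (lam w : ι → ℝ) (i₀ : ι), (∀ i, 0 ≤ lam i ∧ lam i ≤ lam i₀) ∧ 0 < lam i₀ ∧ w i₀ = 1 ∧
      (∀ i, w i = 0 ∨ w i = 1) ∧
      (∀ m : ℕ, HasSum (fun i => lam i ^ (m + 2)) (wilsonFinTorusPartition ρ β b₁ b₂ b₃ (m + 2))) ∧
      (∀ m : ℕ, HasSum (fun i => lam i ^ (m + 2) * w i)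
        ((Fintype.card Γ : ℝ)⁻¹ * ∑ a : Γ, wilsonFinTorusTwistedPartition ρ β (Z a) b₁ b₂ b₃ (m + 2))) := by
  -- the slice, its Haar measure, the slice kernel and its transfer operator
  set μ : Measure (FinSpatialSite b₁ b₂ b₃ × Fin 3 → G) :=
    Measure.pi fun _ : FinSpatialSite b₁ b₂ b₃ × Fin 3 => haarProbability G with hμ
  set K : (FinSpatialSite b₁ b₂ b₃ × Fin 3 → G) → (FinSpatialSite b₁ b₂ b₃ × Fin 3 → G) → ℝ :=
    finTorusSliceKernel ρ β with hKdef
  have hK : StronglyMeasurable (uncurry K) := stronglyMeasurable_uncurry_finTorusSliceKernel ρ hρ β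
  obtain ⟨C, hC⟩ := exists_norm_finTorusSliceKernel_le (b₁ := b₁) (b₂ := b₂) (b₃ := b₃) ρ hρ β
  have hsymm : ∀ x y, K x y = K y x := finTorusSliceKernel_symm ρ hρu β
  obtain ⟨A, hA⟩ := exists_kernelOp (μ := μ) hK hC
  have hsa : IsSelfAdjoint A := isSelfAdjoint_kernelOp hK hC hsymm hA
  have hC0 : 0 ≤ C := (norm_nonneg _).trans (hC 1 1)
  have hcpt : IsCompactOperator A := isCompactOperator_kernelOp hC hC0 hA
  have hApos : ∀ φ : Lp ℝ 2 μ, 0 ≤ @inner ℝ _ _ (A φ) φ := fun φ => by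
    rw [real_inner_comm]
    exact inner_kernelOp_self_nonneg hA (posType_finTorusSliceKernel ρ hρ hρu hβ) φ
  -- the slice twists `T a` of the twist group
  have hzmul : ∀ e e' : Γ, Z e * Z e' = Z (e + e') := fun e e' => (hZadd e e').symm
  set T : Γ → (FinSpatialSite b₁ b₂ b₃ × Fin 3 → G) → (FinSpatialSite b₁ b₂ b₃ × Fin 3 → G) :=
    fun e => finSliceTwist (Z e) with hT
  have hTmp : ∀ e, MeasurePreserving (T e) μ μ := fun e => measurePreserving_finSliceTwist (Z e)
  have hTT : ∀ e e' x, T e (T e' x) = T (e + e') x := fun e e' x => by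
    simp only [hT, finSliceTwist_finSliceTwist, hzmul]
  have hT0 : ∀ x, T 0 x = x := fun x => by
    simp only [hT, hZ0, finSliceTwist_one, id]
  have hTinv : ∀ e x, T e (T (-e) x) = x := fun e x => by rw [hTT, add_neg_cancel, hT0]
  have hTinv' : ∀ e x, T (-e) (T e x) = x := fun e x => by rw [hTT, neg_add_cancel, hT0]
  have hKT : ∀ e x y, K (T e x) (T e y) = K x y := fun e x y => finTorusSliceKernel_finSliceTwist ρ (hZc e) β x y
  have hcov : ∀ (e) (F : (FinSpatialSite b₁ b₂ b₃ × Fin 3 → G) → ℝ), ∫ x, F (T e x) ∂μ = ∫ x, F x ∂μ :=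
    fun e F => IRcofAdaptedSpectralDataCore.integral_comp_finSliceTwist (Z e) F
  -- the Koopman isometries `U e φ = φ ∘ T e` and the flux projection `P = n⁻¹ Σ_e U e`
  set U : Γ → (Lp ℝ 2 μ →L[ℝ] Lp ℝ 2 μ) :=
    fun e => (Lp.compMeasurePreservingₗᵢ ℝ (T e) (hTmp e)).toContinuousLinearMap with hU
  have hUae : ∀ (e) (φ : Lp ℝ 2 μ), (U e φ : (FinSpatialSite b₁ b₂ b₃ × Fin 3 → G) → ℝ) =ᵐ[μ] fun x => φ (T e x) :=
    fun e φ => Lp.coeFn_compMeasurePreserving φ (hTmp e)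
  have hUU : ∀ (e e') (φ : Lp ℝ 2 μ), U e (U e' φ) = U (e' + e) φ := by
    intro e e' φ
    refine Lp.ext ?_
    filter_upwards [hUae e (U e' φ), (hTmp e).quasiMeasurePreserving.ae_eq_comp (hUae e' φ), hUae (e' + e) φ]
      with x h1 h2 h3
    rw [h1, h3]
    have h2' : (U e' φ) (T e x) = φ (T e' (T e x)) := h2
    rw [h2', hTT]
  have hUadj : ∀ (e) (φ ψ : Lp ℝ 2 μ), @inner ℝ _ _ (U e φ) ψ = @inner ℝ _ _ φ (U (-e) ψ) := by
    intro e φ ψ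
    rw [inner_eq_integral, inner_eq_integral]
    have h1 : ∫ x, (U e φ) x * ψ x ∂μ = ∫ x, φ (T e x) * ψ x ∂μ :=
      integral_congr_ae (by filter_upwards [hUae e φ] with x hx; rw [hx])
    have h2 : ∫ x, φ x * (U (-e) ψ) x ∂μ = ∫ x, φ x * ψ (T (-e) x) ∂μ :=
      integral_congr_ae (by filter_upwards [hUae (-e) ψ] with x hx; rw [hx])
    rw [h1, h2, ← hcov e (fun x => φ x * ψ (T (-e) x))]
    refine integral_congr_ae (Eventually.of_forall fun x => ?_)
    simp only [hTinv']
  have hAU : ∀ (e) (φ : Lp ℝ 2 μ), A (U e φ) = U e (A φ) := by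
    intro e φ
    refine Lp.ext ?_
    have h3 : ∀ x, ∫ y, K x y * (U e φ) y ∂μ = ∫ y, K (T e x) y * φ y ∂μ := by
      intro x
      have h1 : ∫ y, K x y * (U e φ) y ∂μ = ∫ y, K x y * φ (T e y) ∂μ :=
        integral_congr_ae (by filter_upwards [hUae e φ] with y hy; rw [hy])
      rw [h1, ← hcov (-e) (fun y => K x y * φ (T e y))]
      refine integral_congr_ae (Eventually.of_forall fun y => ?_)
      simp only
      rw [hTinv, ← hKT e x (T (-e) y), hTinv]
    filter_upwards [hA (U e φ), hUae e (A φ), (hTmp e).quasiMeasurePreserving.ae_eq_comp (hA φ)] with x h1 h2 h4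
    rw [h1, h3 x, h2]
    exact h4.symm
  set P : Lp ℝ 2 μ →L[ℝ] Lp ℝ 2 μ := (Fintype.card Γ : ℝ)⁻¹ • ∑ e, U e with hP
  have hPapply : ∀ φ : Lp ℝ 2 μ, P φ = (Fintype.card Γ : ℝ)⁻¹ • ∑ e, U e φ := fun φ => by
    simp only [hP, smul_apply, sum_apply]
  have hn' : (Fintype.card Γ : ℝ) ≠ 0 := Nat.cast_ne_zero.2 Fintype.card_ne_zero
  have hP2 : ∀ φ, P (P φ) = P φ := by
    intro φ
    have hsumU : ∀ e, ∑ e', U e (U e' φ) = ∑ e'', U e'' φ := fun e => by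
      simp_rw [hUU]
      exact Fintype.sum_equiv (Equiv.addRight e) _ _ fun e' => rfl
    rw [hPapply (P φ), hPapply φ]
    simp_rw [map_smul, map_sum, hsumU, Finset.sum_const, Finset.card_univ, ← Nat.cast_smul_eq_nsmul ℝ, smul_smul]
    rw [inv_mul_cancel_left₀ hn']
  have hPsym : ∀ φ ψ : Lp ℝ 2 μ, @inner ℝ _ _ (P φ) ψ = @inner ℝ _ _ φ (P ψ) := by
    intro φ ψ
    rw [hPapply, hPapply, real_inner_smul_left, real_inner_smul_right, sum_inner, inner_sum]
    congr 1
    simp_rw [hUadj]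
    exact Fintype.sum_equiv (Equiv.neg Γ) _ _ fun e => rfl
  have hPsa : IsSelfAdjoint P := by
    rw [ContinuousLinearMap.isSelfAdjoint_iff_isSymmetric]
    intro φ ψ
    exact hPsym φ ψ
  have hcomm : ∀ φ, A (P φ) = P (A φ) := fun φ => by
    rw [hPapply, hPapply, map_smul, map_sum]
    simp_rw [hAU]
  -- ONE diagonalisation, adapted to `P`
  obtain ⟨s, bb, lam, w, hbs, hb, hlam0, hw, hPb⟩ :=
    IRcofAdaptedSpectralDataCore.exists_adapted_eigenbasis hcpt hsa hApos hPsa hP2 hcomm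
  haveI : Fact ((2 : ℝ≥0∞) ≠ ⊤) := ⟨ENNReal.ofNat_ne_top⟩
  have hon : Orthonormal ℝ ((↑) : s → Lp ℝ 2 μ) := hbs ▸ bb.orthonormal
  haveI : Countable s := (hon.countable_of_separableSpace (𝕜 := ℝ)).to_subtype
  -- the flux weight of an eigenvector: `n⁻¹ Σ_e ⟪U_e A bᵢ, A bᵢ⟫ = λᵢ² wᵢ`
  have hg : ∀ e i, ∫ x, (∫ y, K (T e x) y * bb i y ∂μ) * (∫ y, K x y * bb i y ∂μ) ∂μ =
      lam i * lam i * @inner ℝ _ _ (U e (bb i)) (bb i) := by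
    intro e i
    have h1 : @inner ℝ _ _ (U e (A (bb i))) (A (bb i)) =
        ∫ x, (∫ y, K (T e x) y * bb i y ∂μ) * (∫ y, K x y * bb i y ∂μ) ∂μ := by
      rw [inner_eq_integral]
      refine integral_congr_ae ?_
      filter_upwards [hUae e (A (bb i)), (hTmp e).quasiMeasurePreserving.ae_eq_comp (hA (bb i)), hA (bb i)]
        with x h1 h2 h3
      rw [h1, h3]
      have h2' : (A (bb i)) (T e x) = ∫ y, K (T e x) y * bb i y ∂μ := h2
      rw [h2']
    rw [← h1, hb i, map_smul, real_inner_smul_left, real_inner_smul_right, mul_assoc]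
  have hflux : ∀ (m : ℕ) (i : s), (Fintype.card Γ : ℝ)⁻¹ * ∑ e, lam i ^ m *
      ∫ x, (∫ y, K (T e x) y * bb i y ∂μ) * (∫ y, K x y * bb i y ∂μ) ∂μ = lam i ^ (m + 2) * w i := by
    intro m i
    simp_rw [hg]
    have h1 : (Fintype.card Γ : ℝ)⁻¹ * ∑ e, lam i ^ m * (lam i * lam i * @inner ℝ _ _ (U e (bb i)) (bb i)) =
        lam i ^ (m + 2) * @inner ℝ _ _ (P (bb i)) (bb i) := by
      rw [hPapply, real_inner_smul_left, sum_inner, Finset.mul_sum, Finset.mul_sum, Finset.mul_sum]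
      exact Finset.sum_congr rfl fun e _ => by ring
    rw [h1]
    rcases eq_or_ne (lam i) 0 with h0 | h0
    · rw [h0, zero_pow (Nat.succ_ne_zero _), zero_mul, zero_mul]
    · rw [hPb i h0, real_inner_smul_left, real_inner_self_eq_norm_sq, bb.orthonormal.norm_eq_one i, one_pow, mul_one]
  -- the vacuum: the top eigenvalue `λ_{i₀} = ‖A‖ > 0` (Jentzsch ∕ Perron–Frobenius) is NEUTRAL, `w i₀ = 1`
  have hKpos : ∀ x y, 0 < K x y := finTorusSliceKernel_pos ρ hρ β
  have himp : IsPositivityImproving A := isPositivityImproving_kernelOp hK hC hKpos hA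
  have hA0 : A ≠ 0 := kernelOp_ne_zero hK hC hKpos (IsProbabilityMeasure.ne_zero _) hA
  obtain ⟨ψ, hψ0, hψ⟩ := himp.exists_top_eigenvector_of_isCompactOperator hsa hcpt hA0
  obtain ⟨i₀, hi₀⟩ := exists_index_eq_norm bb hsa hb hψ0 hψ
  have hle : ∀ i, lam i ≤ lam i₀ := fun i => (le_abs_self _).trans ((abs_lam_le_norm hb i).trans hi₀.ge)
  have hL0 : 0 < lam i₀ := by rw [hi₀]; exact norm_pos_iff.2 hA0
  have hw0 : w i₀ = 1 := by
    have hUa : ∀ e, @inner ℝ _ _ (U e (bb i₀)) (bb i₀) = 1 := by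
      intro e
      have htop := integral_twisted_coeff_top hK hC hsymm hKpos hA hb (hTmp e) (hKT e) hi₀ hL0.ne'
      rw [hg e i₀, sq] at htop
      have hl2 : lam i₀ * lam i₀ ≠ 0 := mul_ne_zero hL0.ne' hL0.ne'
      calc @inner ℝ _ _ (U e (bb i₀)) (bb i₀) = lam i₀ * lam i₀ * @inner ℝ _ _ (U e (bb i₀)) (bb i₀) / (lam i₀ * lam i₀) := by
            field_simp
        _ = 1 := by rw [htop]; field_simp
    have hPin : @inner ℝ _ _ (P (bb i₀)) (bb i₀) = 1 := by
      rw [hPapply, real_inner_smul_left, sum_inner]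
      simp_rw [hUa]
      rw [Finset.sum_const, Finset.card_univ, nsmul_eq_mul, mul_one, inv_mul_cancel₀ hn']
    rw [hPb i₀ hL0.ne', real_inner_smul_left, real_inner_self_eq_norm_sq, bb.orthonormal.norm_eq_one i₀, one_pow,
      mul_one] at hPin
    exact hPin
  refine ⟨s, lam, w, i₀, fun i => ⟨hlam0 i, hle i⟩, hL0, hw0, hw, fun m => ?_, fun m => ?_⟩
  · -- `Z(b, m+2) = Σ λᵢ^{m+2}` (Montvay–Münster (3.145))
    rw [wilsonFinTorusPartition_eq_integral_prod_finTorusSliceKernel_succ ρ hρ β b₁ b₂ b₃ m]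
    exact hasSum_pow_integral_cyclic hK hC hsymm hA hb hlam0 m
  · -- `n⁻¹ Σ_e Z^{(gᵉ)}(b, m+2) = Σ λᵢ^{m+2} wᵢ` ('t Hooft (5.3) in the adapted eigenbasis)
    have he : ∀ e : Γ, HasSum (fun i : s => lam i ^ m *
        ∫ x, (∫ y, K (T e x) y * bb i y ∂μ) * (∫ y, K x y * bb i y ∂μ) ∂μ)
        (wilsonFinTorusTwistedPartition ρ β (Z e) b₁ b₂ b₃ (m + 2)) := fun e => by
      rw [wilsonFinTorusTwistedPartition_eq_integral_iterate ρ hρ β (hZc e) b₁ b₂ b₃ m]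
      exact hasSum_pow_integral_iterate_twisted hK hC hsymm hA hb (hTmp e).measurable m
    have hs := (hasSum_sum fun e (_ : e ∈ (Finset.univ : Finset Γ)) => he e).mul_left
      ((Fintype.card Γ : ℝ)⁻¹)
    refine hs.congr_fun fun i => ?_
    exact (hflux m i).symm

/-! ### §2 `projZ` with the vacuum index; interlacing from «charged ≤ (κ/2)·excited neutral» -/

/-- ★ **`projZ` in an adapted eigenbasis, with the neutral vacuum** (`β ≥ 0`, continuous unitary `ρ`, central `z`, `0 < n`, `z ^ n = 1`,
every `L`): `Z(L³×(m+2)) = Σ λᵢ^{m+2}`, `projZ ρ β z n L (m+2) = Σ λᵢ^{m+2} wᵢ`, `wᵢ ∈ {0,1}`, and the top eigenvalue `λ_{i₀} > 0` has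
`w_{i₀} = 1`. [cite: tHooft1979Flux, §5 (5.1)–(5.4)] [cite: ReedSimonIV1978, Thm XIII.43 and Thm XIII.44] -/
theorem adaptedSpectralData_projZ_vacuum (hρ : Continuous ρ) (hρu : ∀ x, ρ x ∈ Matrix.unitaryGroup (Fin N) ℂ) {β : ℝ}
    (hβ : 0 ≤ β) {z : G} (hz : z ∈ Subgroup.center G) {n : ℕ} (hn : 0 < n) (hzn : z ^ n = 1) (L : ℕ) :
    ∃ (ι : Type) (lam w : ι → ℝ) (i₀ : ι), (∀ i, 0 ≤ lam i ∧ lam i ≤ lam i₀) ∧ 0 < lam i₀ ∧ w i₀ = 1 ∧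
      (∀ i, w i = 0 ∨ w i = 1) ∧
      (∀ m : ℕ, HasSum (fun i => lam i ^ (m + 2)) (wilsonFinTorusPartition ρ β L L L (m + 2))) ∧
      (∀ m : ℕ, HasSum (fun i => lam i ^ (m + 2) * w i) (projZ ρ β z n L (m + 2))) := by
  obtain ⟨q, rfl⟩ : ∃ q, n = q + 1 := ⟨n - 1, by omega⟩
  obtain ⟨ι, lam, w, i₀, hlam, hL0, hw0, hw, hZ, hP⟩ := adaptedSpectralData_twistGroup_vacuum hρ hρu hβ
    (Γ := Fin 3 → Fin (q + 1)) (Z := fun k => zVec z (fun i => (k i : ℕ))) (zVec_fin_zero z q) (zVec_fin_add hzn)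
    (fun k i => zVec_castSucc_mem_center hz _ i) L L L
  refine ⟨ι, lam, w, i₀, hlam, hL0, hw0, hw, hZ, fun m => ?_⟩
  have h := hP m
  unfold projZ
  simp_rw [eTwist_eq_elecMag, wilsonFinTorusTensorTwistedPartition_elecMag_one]
  exact h

/-- **Real-number core of the reduction**: with `N = v + E`, `N₂ ≤ v² + v·E`, `0 ≤ v`, `0 ≤ E`, `0 ≤ κ`, the bound `C ≤ κ/2 · E` gives
`N + C ≤ N + κ (N − √N₂)` (since `√N₂ ≤ v + E/2`). -/
theorem interlaced_arith {v E N₂ C κ : ℝ} (hv : 0 ≤ v) (hE : 0 ≤ E) (hκ : 0 ≤ κ) (hN₂ : N₂ ≤ v ^ 2 + v * E)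
    (hC : C ≤ κ / 2 * E) : v + E + C ≤ v + E + κ * (v + E - Real.sqrt N₂) := by
  have hsq : Real.sqrt N₂ ≤ v + E / 2 := by
    have h1 : N₂ ≤ (v + E / 2) ^ 2 := by nlinarith [sq_nonneg E]
    calc Real.sqrt N₂ ≤ Real.sqrt ((v + E / 2) ^ 2) := Real.sqrt_le_sqrt h1
      _ = v + E / 2 := Real.sqrt_sq (by positivity)
  nlinarith

/-- ★★ **Interlacing from «charged spectral weight ≤ (κ/2) × excited neutral spectral weight»** (`β ≥ 0`, continuous unitary `ρ`,
central `z`, `0 < n`, `z ^ n = 1`, `8 ≤ L`, `t = L/4`).  In an adapted eigenbasis with neutral vacuum `i₀`: IF `0 ≤ κ` and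
`Σᵢ λᵢ^t (1 − wᵢ) ≤ (κ/2) · (Σᵢ λᵢ^t wᵢ − λ_{i₀}^t)` — electric-flux weight at most `κ/2` times the EXCITED glue weight — THEN
`InterlacedAt ρ β z n κ L` (VERBATIM body: `Z(L³×t) ≤ projZ(t) + κ·(projZ(t) − √projZ(2t))`).  This is the honest spectral target a proof
of stub I (`FluxInterlacingEv`, IDEA-NEEDED: it is conditional confinement) has to reach from neutral `ε₀`-purity; nothing here reaches it.
[cite: tHooft1979Flux, §5 (5.1)–(5.4)] -/
theorem interlaced_of_charged_le_half_excited (hρ : Continuous ρ) (hρu : ∀ x, ρ x ∈ Matrix.unitaryGroup (Fin N) ℂ) {β : ℝ}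
    (hβ : 0 ≤ β) {z : G} (hz : z ∈ Subgroup.center G) {n : ℕ} (hn : 0 < n) (hzn : z ^ n = 1) {L : ℕ} (hL : 8 ≤ L) :
    ∃ (ι : Type) (lam w : ι → ℝ) (i₀ : ι), (∀ i, 0 ≤ lam i ∧ lam i ≤ lam i₀) ∧ 0 < lam i₀ ∧ w i₀ = 1 ∧
      (∀ i, w i = 0 ∨ w i = 1) ∧
      (∀ m : ℕ, HasSum (fun i => lam i ^ (m + 2)) (wilsonFinTorusPartition ρ β L L L (m + 2))) ∧
      (∀ m : ℕ, HasSum (fun i => lam i ^ (m + 2) * w i) (projZ ρ β z n L (m + 2))) ∧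
      ∀ κ : ℝ, 0 ≤ κ →
        ∑' i, lam i ^ (L / 4) * (1 - w i) ≤ κ / 2 * (∑' i, lam i ^ (L / 4) * w i - lam i₀ ^ (L / 4)) →
          wilsonFinTorusPartition ρ β L L L (L / 4) ≤
            projZ ρ β z n L (L / 4) + κ * (projZ ρ β z n L (L / 4) - Real.sqrt (projZ ρ β z n L (2 * (L / 4)))) := by
  obtain ⟨ι, lam, w, i₀, hlam, hL0, hw0, hw, hZ, hP⟩ := adaptedSpectralData_projZ_vacuum hρ hρu hβ hz hn hzn L
  refine ⟨ι, lam, w, i₀, hlam, hL0, hw0, hw, hZ, hP, fun κ hκ hC => ?_⟩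
  obtain ⟨m, hm⟩ : ∃ m, L / 4 = m + 2 := ⟨L / 4 - 2, by omega⟩
  rw [hm] at hC
  rw [hm, show 2 * (m + 2) = 2 * m + 2 + 2 by ring]
  -- names: v = λ₀^t, N = projZ(t) = v + E, N₂ = projZ(2t), C = Z − N
  have hw01 : ∀ i, 0 ≤ w i ∧ w i ≤ 1 := fun i => by rcases hw i with h | h <;> rw [h] <;> norm_num
  have hCsum : HasSum (fun i => lam i ^ (m + 2) * (1 - w i))
      (wilsonFinTorusPartition ρ β L L L (m + 2) - projZ ρ β z n L (m + 2)) := by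
    have hfun : (fun i => lam i ^ (m + 2) * (1 - w i)) = fun i => lam i ^ (m + 2) - lam i ^ (m + 2) * w i := by
      funext i; ring
    rw [hfun]
    exact (hZ m).sub (hP m)
  rw [hCsum.tsum_eq, (hP m).tsum_eq] at hC
  -- `projZ(2t) ≤ λ₀^{2t} + λ₀^t · E(t)`: termwise `λᵢ^{2t} wᵢ ≤ λ₀^t λᵢ^t wᵢ`, with equality budget at `i₀`
  have hterm : ∀ i, lam i ^ (2 * m + 2 + 2) * w i ≤ lam i₀ ^ (m + 2) * (lam i ^ (m + 2) * w i) := by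
    intro i
    rw [show 2 * m + 2 + 2 = (m + 2) + (m + 2) by ring, pow_add, mul_assoc]
    exact mul_le_mul_of_nonneg_right (pow_le_pow_left₀ (hlam i).1 (hlam i).2 _)
      (mul_nonneg (pow_nonneg (hlam i).1 _) (hw01 i).1)
  have hN₂ : projZ ρ β z n L (2 * m + 2 + 2) ≤ lam i₀ ^ (m + 2) * projZ ρ β z n L (m + 2) :=
    hasSum_le hterm (hP (2 * m + 2)) ((hP m).mul_left _)
  -- `λ₀^t ≤ projZ(t)` (the vacuum term is one of the neutral terms)
  have hvN : lam i₀ ^ (m + 2) ≤ projZ ρ β z n L (m + 2) := by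
    have h1 := (hP m).summable.sum_le_tsum {i₀} (fun i _ => mul_nonneg (pow_nonneg (hlam i).1 _) (hw01 i).1)
    rw [Finset.sum_singleton, hw0, mul_one, (hP m).tsum_eq] at h1
    exact h1
  have hv : 0 ≤ lam i₀ ^ (m + 2) := pow_nonneg hL0.le _
  -- assemble
  have key := interlaced_arith (v := lam i₀ ^ (m + 2)) (E := projZ ρ β z n L (m + 2) - lam i₀ ^ (m + 2))
    (N₂ := projZ ρ β z n L (2 * m + 2 + 2))
    (C := wilsonFinTorusPartition ρ β L L L (m + 2) - projZ ρ β z n L (m + 2)) (κ := κ) hv (sub_nonneg.2 hvN) hκ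
    (by nlinarith [hN₂]) hC
  linarith

end Summit.QuantumFields.YangMills.Theorems.IRcofFluxProjectionVacuumSector

end
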